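import Literature.Computability.AlgebraicComplexity.BD17ExponentialDescartesParity
import Literature.Computability.AlgebraicComplexity.BD17DescartesCircuitsProofs
import Mathlib.Analysis.SpecialFunctions.Pow.Real
import Mathlib.Analysis.SpecialFunctions.Log.Basic
import HarnessLib

/-!
# Descartes' rule of signs for monomials with REAL exponents on `(0, +∞)` (BD 2017 §4.1)

THEOREMS ONLY (0 definitions, 0 named facts). Bihan–Dickenstein 2017 [BihanDickenstein2017],
§4.1 (arXiv p0010:L10–13): "Descartes' rule of signs concerns polynomials, that is, analytic
functions of a single variable that can be written as real linear combinations of monomials with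
integer exponents. In fact, the same result holds for monomials with real exponents, which can be
evaluated on `ℝ_{>0}`." and (p0010:L23–24): "The classical Descartes' rule of signs asserts that
monomial bases `(1, y, …, y^{s−1})` satisfy Descartes' rule of signs on the open interval `(0,+∞)`."
In the tree's vocabulary (`BD17.SatisfiesDescartesRule`, Def. 4.1 = BD17 "Definition 18", roots
counted WITH multiplicity):

* `BD17.rootCountMult_comp_exp` — the substitution `x = e^t`: for any `f : ℝ → ℝ`, the zeros of
  `t ↦ f(e^t)` on `ℝ` and of `f` on `(0, ∞)` correspond, with the same multiplicities
  (Mathlib's `analyticOrderAt_comp_of_deriv_ne_zero`), so the two `rootCountMult`s agree;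
* `BD17.satisfiesDescartesRule_rpow` — for real exponents `d_1 < ⋯ < d_s`, the sequence
  `(x^{d_1}, …, x^{d_s})` satisfies Descartes' rule of signs on `(0, +∞)` (from the exponential
  Descartes system `BD17.satisfiesDescartesRule_exp`, Pólya–Szegő V 77, by `x = e^t`);
* `BD17.even_signVar_sub_rootCountMult_rpowSum` — the same with the parity clause: `Z ≤ C` and
  `C − Z` even (Pólya–Szegő V 36/37 for positive zeros, real exponents allowed);
* `BD17.satisfiesDescartesRule_pow` — the classical monomial basis `(1, y, …, y^{s−1})`;
* `BD17.satisfiesDescartesRule_rev` — (p0010:L25–26) a reversed Descartes system is a Descartes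
  system (`Var` is invariant under reversal);
* `BD17.rootCountMult_rpowSum_le` — the fewnomial form (p0004:L24–25: "the number of real roots of
  a real univariate polynomial can be bounded in terms of the number of monomials (with nonzero
  coefficient), independently of its degree"): a nonzero combination of `s` real-exponent
  monomials has at most `s − 1` roots in `(0, +∞)` counted with multiplicity.

Mathlib already has Descartes' rule for `Polynomial`s (`Polynomial.roots_countP_pos_le_signVariations`
style statements); the statements here are the real-exponent / analytic-multiplicity ones BD17 uses.
Cell `val-lit`, row X4-BD17 (LADDER-VALIANT V1 ideation; the typed tool a "MatrixDescartes" route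
would start from). Honest framing: classical; nothing here bears on VP versus VNP.

## References

* [BihanDickenstein2017] F. Bihan, A. Dickenstein, *Descartes' rule of signs for polynomial systems
  supported on circuits*, IMRN 2017 (22), 6867–6893, arXiv:1601.05826: §1 (p0004:L24–25), §4.1
  Def. 4.1 and the two quoted sentences (p0010:L10–13, L23–24).
* [PolyaSzego1998] G. Pólya, G. Szegő, *Problems and Theorems in Analysis II* (1998 printing):
  Part V Chap. 1 problems 36, 37 (p. 41; held text p0075:L1–6) and §6 problem 77.
-/

noncomputable section

open Set Filter Topology Finset
open Literature.Algebra.Polynomial (signVar signVarAux)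

namespace Literature.Computability.AlgebraicComplexity

namespace BD17

/-! ### The substitution `x = e^t` -/

/-- The zeros of `t ↦ f(e^t)` on `ℝ` are carried by `exp` bijectively onto the zeros of `f` on
`(0, +∞)` (plumbing for the substitution `x = e^t`). -/
@[folklore] private theorem bijOn_exp_zeros (f : ℝ → ℝ) :
    Set.BijOn Real.exp {t | t ∈ (Set.univ : Set ℝ) ∧ f (Real.exp t) = 0}
      {x | x ∈ Set.Ioi (0 : ℝ) ∧ f x = 0} := by
  refine ⟨fun t ht => ⟨Real.exp_pos t, ht.2⟩, Real.exp_injective.injOn, fun x hx => ?_⟩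
  refine ⟨Real.log x, ⟨Set.mem_univ _, ?_⟩, Real.exp_log hx.1⟩
  simpa [Real.exp_log hx.1] using hx.2

/-- Under `x = e^t` the multiplicity of a zero is preserved: the analytic order of `t ↦ f(e^t)` at
`t` is that of `f` at `e^t` (`exp` is an analytic change of variable with nonvanishing
derivative; Mathlib's `analyticOrderAt_comp_of_deriv_ne_zero`).
[cite: BihanDickenstein2017, §4.1 (p0010:L12–13)] -/
theorem analyticOrderNatAt_comp_exp (f : ℝ → ℝ) (t : ℝ) :
    analyticOrderNatAt (fun t => f (Real.exp t)) t = analyticOrderNatAt f (Real.exp t) := by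
  have h : analyticOrderAt (f ∘ Real.exp) t = analyticOrderAt f (Real.exp t) :=
    analyticOrderAt_comp_of_deriv_ne_zero analyticAt_rexp
      (by rw [Real.deriv_exp]; exact Real.exp_ne_zero t)
  unfold analyticOrderNatAt
  rw [show (fun t => f (Real.exp t)) = f ∘ Real.exp from rfl, h]

/-- **The substitution `x = e^t`.** For any `f : ℝ → ℝ`: `f` has finitely many zeros in `(0, +∞)`
iff `t ↦ f(e^t)` has finitely many zeros in `ℝ`, and the numbers of zeros counted with multiplicity
(`BD17.rootCountMult`) agree. [cite: BihanDickenstein2017, §4.1 (p0010:L12–13)] -/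
theorem rootCountMult_comp_exp (f : ℝ → ℝ) :
    ({t | t ∈ (Set.univ : Set ℝ) ∧ f (Real.exp t) = 0}.Finite ↔
        {x | x ∈ Set.Ioi (0 : ℝ) ∧ f x = 0}.Finite) ∧
      rootCountMult (fun t => f (Real.exp t)) (Set.univ : Set ℝ) =
        rootCountMult f (Set.Ioi 0) := by
  have hbij := bijOn_exp_zeros f
  refine ⟨?_, ?_⟩
  · rw [← hbij.image_eq, Set.finite_image_iff hbij.2.1]
  · unfold rootCountMult
    exact finsum_mem_eq_of_bijOn Real.exp hbij fun t _ => analyticOrderNatAt_comp_exp f t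

/-- The combination `Σ a_i x^{d_i}` read through `x = e^t` is the exponential sum `Σ a_i e^{d_i t}`.
[cite: BihanDickenstein2017, §4.1 (p0010:L12–13)] -/
theorem linComb_rpow_comp_exp {s : ℕ} (d : Fin s → ℝ) (a : Fin s → ℝ) :
    (fun t => linComb a (fun i (x : ℝ) => x ^ (d i)) (Real.exp t)) =
      linComb a (fun i t => Real.exp (d i * t)) := by
  funext t
  simp only [linComb]
  refine Finset.sum_congr rfl fun i _ => ?_
  rw [mul_comm (d i) t, Real.exp_mul]

/-! ### Descartes' rule of signs for real exponents on `(0, +∞)` -/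

/-- **BD 2017 §4.1 / Pólya–Szegő V 36–37 with real exponents.** For real `d_1 < ⋯ < d_s` and
`a ≠ 0`, the combination `F(x) = Σ a_i x^{d_i}` has finitely many zeros in `(0, +∞)`, their number
`Z` counted with multiplicity satisfies `Z ≤ C` AND `C − Z` is even, `C` = the number of sign
changes of `(a_1, …, a_s)`. [cite: BihanDickenstein2017, §4.1 (p0010:L10–13)] -/
theorem even_signVar_sub_rootCountMult_rpowSum {s : ℕ} (d : Fin s → ℝ) (hd : StrictMono d)
    (a : Fin s → ℝ) (ha : a ≠ 0) :
    {x | x ∈ Set.Ioi (0 : ℝ) ∧ linComb a (fun i (x : ℝ) => x ^ (d i)) x = 0}.Finite ∧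
      rootCountMult (linComb a (fun i (x : ℝ) => x ^ (d i))) (Set.Ioi 0) ≤ signVar (List.ofFn a) ∧
      Even (signVar (List.ofFn a) -
        rootCountMult (linComb a (fun i (x : ℝ) => x ^ (d i))) (Set.Ioi 0)) := by
  obtain ⟨hfin, -⟩ := rootCountMult_expSum_le_signVar d hd a ha
  obtain ⟨hle, heven⟩ := even_signVar_sub_rootCountMult_expSum d hd a ha
  obtain ⟨hfinT, hcount⟩ := rootCountMult_comp_exp (linComb a (fun i (x : ℝ) => x ^ (d i)))
  have hpt : ∀ t, linComb a (fun i (x : ℝ) => x ^ (d i)) (Real.exp t) =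
      linComb a (fun i t => Real.exp (d i * t)) t :=
    fun t => congrFun (linComb_rpow_comp_exp d a) t
  rw [linComb_rpow_comp_exp d a] at hcount
  simp only [hpt] at hfinT
  exact ⟨hfinT.mp hfin, hcount ▸ hle, hcount ▸ heven⟩

/-- **BD 2017 §4.1** (p0010:L12–13: "the same result holds for monomials with real exponents, which
can be evaluated on `ℝ_{>0}`"): for real exponents `d_1 < ⋯ < d_s` the sequence `(x^{d_1}, …, x^{d_s})`
satisfies Descartes' rule of signs (Def. 4.1, roots with multiplicity) on `(0, +∞)`.
[cite: BihanDickenstein2017, §4.1 (p0010:L10–13)] -/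
theorem satisfiesDescartesRule_rpow {s : ℕ} (d : Fin s → ℝ) (hd : StrictMono d) :
    SatisfiesDescartesRule (fun i (x : ℝ) => x ^ (d i)) (Set.Ioi 0) := fun a ha =>
  let h := even_signVar_sub_rootCountMult_rpowSum d hd a ha
  ⟨h.1, h.2.1⟩

/-- **BD 2017 §4.1** (p0010:L23–24: "The classical Descartes' rule of signs asserts that monomial
bases `(1, y, …, y^{s−1})` satisfy Descartes' rule of signs on the open interval `(0,+∞)`").
[cite: BihanDickenstein2017, §4.1 (p0010:L23–24)] -/
theorem satisfiesDescartesRule_pow (s : ℕ) :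
    SatisfiesDescartesRule (fun (i : Fin s) (x : ℝ) => x ^ (i : ℕ)) (Set.Ioi 0) := by
  have hmono : StrictMono (fun i : Fin s => ((i : ℕ) : ℝ)) := fun i j hij => by
    show ((i : ℕ) : ℝ) < ((j : ℕ) : ℝ)
    exact_mod_cast hij
  have h := satisfiesDescartesRule_rpow (fun i : Fin s => ((i : ℕ) : ℝ)) hmono
  have hfun : (fun (i : Fin s) (x : ℝ) => x ^ (((i : ℕ) : ℝ))) = fun (i : Fin s) (x : ℝ) => x ^ (i : ℕ) := by
    funext i x
    exact Real.rpow_natCast x i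
  rwa [hfun] at h

/-- **Fewnomial bound in one variable** (BD 2017 §1, p0004:L24–25: "the number of real roots of a
real univariate polynomial can be bounded in terms of the number of monomials (with nonzero
coefficient), independently of its degree"): a nonzero real combination of `s` monomials with real
exponents has at most `s − 1` roots in `(0, +∞)` counted with multiplicity.
[cite: BihanDickenstein2017, §1 (p0004:L24–25) and §4.1] -/
theorem rootCountMult_rpowSum_le {s : ℕ} (d : Fin s → ℝ) (hd : StrictMono d)
    (a : Fin s → ℝ) (ha : a ≠ 0) :
    rootCountMult (linComb a (fun i (x : ℝ) => x ^ (d i))) (Set.Ioi 0) ≤ s - 1 := by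
  have h := (even_signVar_sub_rootCountMult_rpowSum d hd a ha).2.1
  refine h.trans ?_
  simpa [List.length_ofFn] using signVar_le_length_sub_one (List.ofFn a)

/-! ### Reversing a Descartes system (BD 2017 §4.1, p0010:L25–26) -/

/-- Appending two entries: the last adjacent pair contributes on its own (plumbing). -/
@[folklore] private theorem signVarAux_append_pair (m : List ℝ) (b a : ℝ) :
    signVarAux (m ++ [b, a]) = signVarAux (m ++ [b]) + (if b * a < 0 then 1 else 0) := by
  induction m with
  | nil => simp [signVarAux]
  | cons c m ih =>
      cases m with
      | nil => simp [signVarAux]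
      | cons d m =>
          simp only [List.cons_append] at ih ⊢
          simp only [signVarAux]
          rw [ih]
          ring

/-- The number of sign changes of a list of reals is invariant under reversal (plumbing). -/
@[folklore] private theorem signVarAux_reverse : ∀ l : List ℝ, signVarAux l.reverse = signVarAux l
  | [] => rfl
  | [a] => by simp [signVarAux]
  | a :: b :: t => by
      have ih := signVarAux_reverse (b :: t)
      rw [List.reverse_cons, List.reverse_cons, List.append_assoc, List.singleton_append,
        signVarAux_append_pair, ← List.reverse_cons, ih]
      simp only [signVarAux]
      rw [mul_comm b a]
      ring

/-- `Var` of a sequence is invariant under reversal (plumbing). -/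
@[folklore] private theorem signVar_reverse (l : List ℝ) : signVar l.reverse = signVar l := by
  unfold signVar
  rw [List.filter_reverse, signVarAux_reverse]

/-- Reversing `List.ofFn` re-indexes by `Fin.rev` (plumbing). -/
@[folklore] private theorem ofFn_rev_eq_reverse {α : Type*} :
    ∀ {s : ℕ} (a : Fin s → α), List.ofFn (fun i => a (Fin.rev i)) = (List.ofFn a).reverse
  | 0, a => by simp
  | n + 1, a => by
      rw [List.ofFn_succ_last (f := a), List.reverse_append,
        ← ofFn_rev_eq_reverse (fun i => a i.castSucc), List.ofFn_succ (f := fun i => a (Fin.rev i))]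
      simp [Fin.rev_succ]

/-- **BD 2017 §4.1** (p0010:L25–26): "We note that if `(h_1, h_2, …, h_s)` satisfies Descartes' rule
of signs on `Δ`, then the same holds true for the sequence `(h_s, h_{s−1}, …, h_1)`." (The combination
with coefficients `a` of the reversed system is the combination with the reversed coefficients of the
original one, and `Var` is invariant under reversal.) [cite: BihanDickenstein2017, §4.1 (p0010:L25–26)] -/
theorem satisfiesDescartesRule_rev {s : ℕ} {h : Fin s → ℝ → ℝ} {Δ : Set ℝ}
    (H : SatisfiesDescartesRule h Δ) :
    SatisfiesDescartesRule (fun i => h (Fin.rev i)) Δ := by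
  intro a ha
  -- reversed coefficients
  set a' : Fin s → ℝ := fun j => a (Fin.rev j) with ha'
  have ha'0 : a' ≠ 0 := by
    intro h0
    apply ha
    funext i
    have := congrFun h0 (Fin.rev i)
    simpa [ha'] using this
  have hcomb : linComb a (fun i => h (Fin.rev i)) = linComb a' h := by
    funext y
    simp only [linComb, ha']
    exact Fintype.sum_equiv Fin.revPerm _ _ fun i => by simp
  obtain ⟨hfin, hle⟩ := H a' ha'0
  rw [hcomb]
  refine ⟨hfin, hle.trans_eq ?_⟩
  rw [show List.ofFn a' = (List.ofFn a).reverse from ofFn_rev_eq_reverse a, signVar_reverse]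

end BD17

end Literature.Computability.AlgebraicComplexity
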